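import Summits.CriticalPhenomena.PercolationContinuityZ3.Theorems.PercNearOneGluingNoHeavyLowerTailSahiE3ProductSections
import Mathlib.Tactic.Linarith
import Mathlib.Tactic.Ring
import Mathlib.Tactic.Positivity
import HarnessLib
import HarnessLib.Audit

/-!
# `NoHeavyLowerTail` (crux stmt-CriticalPhenomena-4575), Sahi programme P4 (Holley / monotone coupling):
# the independent OR-step `V ∨ G` — the CAP inequality of a rank-one composite decouples into the two blocks

Support file (cell `prim-l12`, seat P4, generation 18; `--supports stmt-CriticalPhenomena-4575`).  No named facts, no sorries;
standard axioms; def-free.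

Setting (flow-free form of `…SahiE3CertSandwich`, normalised): finite posets `B, Q`, weights `w, ν' ≥ 0`, subsets `V ⊆ B`, `G ⊆ Q`,
product weight `ν = w ⊗ ν'` on `B × Q`, slot `U = V × Q ∪ B × G`.  A RANK-ONE COMPOSITE is
  `R = (1+d)·w⊗ν'` on `V × G`,  `φ ⊗ ν'` on `V × Gᶜ`,  `w ⊗ ψ` on `Vᶜ × G`,  `0` on `Vᶜ × Gᶜ`
(`φ` on `V`, `ψ` on `G`; numerically — HOME prim-l12-p4 gen-18 memo — every tested `V ∨ G` admits a certificate of this form, and the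
block `V × G` of every certificate is forced to be `(1+d)·ν`).  THEOREM `cap_rankOne`: the cap (upper sandwich) inequality
  (C)  `R(W) + u·ν(W ∖ U) ≤ (1+d)·ν(W ∩ U)`   for every up-set `W` of `B × Q`
follows from two ONE-BLOCK inequalities with a split `μ_V + μ_G ≥ u` of the delivery rate:
  (C_V)  `φ(I ∩ V) + μ_V·w(I ∖ V) ≤ (1+d)·w(I ∩ V)`  for all up-sets `I ⊆ B`,
  (C_G)  `ψ(J ∩ G) + μ_G·ν'(J ∖ G) ≤ (1+d)·ν'(J ∩ G)` for all up-sets `J ⊆ Q`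
(`u, d, μ_V, μ_G` arbitrary reals with `u ≤ μ_V + μ_G`; no Harris hypothesis, `V, G` need not be up-sets).  PROOF: by `Q`-sections,
`R(W) + uν(W∖U) − (1+d)ν(W∩U) = Σ_{b∈V} (φ(b) − (1+d)w(b))·ν'(W_b ∖ G) + Σ_{b∉V} w(b)·[ψ(W_b∩G) + u·ν'(W_b∖G) − (1+d)ν'(W_b∩G)]`; the first
sum, read by `B`-sections `s ∉ G`, is `≤ −μ_V Σ_{b∉V} w(b)ν'(W_b∖G)` by (C_V), and then (C_G) bounds each bracket by `(u − μ_V − μ_G)·ν'(W_b∖G) ≤ 0`.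
With `…SahiE3IndepOrMarginal` (the pair inequality is free for the marginal composite) this isolates what a proof of the independent
OR-step must still do: satisfy the pair inequality (L) with a composite obeying (C_V), (C_G).
-/

namespace Summit.CriticalPhenomena.PercolationContinuityZ3.Theorems.SahiE3IndepOrRankOneCap

open Finset SahiE3ProductSections
open scoped BigOperators

variable {B Q : Type*} [Fintype B] [DecidableEq B] [PartialOrder B] [Fintype Q] [DecidableEq Q] [PartialOrder Q]

omit [PartialOrder B] [PartialOrder Q] in
/-- Interchange over the pairs `(b,t) ∈ X` with `b ∈ V`, `t ∈ H`:
`Σ_{b∈V} c(b)·Σ_{t ∈ X_b ∩ H} e(t) = Σ_{t∈H} e(t)·Σ_{b ∈ X^t ∩ V} c(b)`. [folklore] -/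
theorem interchange (X : Finset (B × Q)) (V : Finset B) (H : Finset Q) (c : B → ℝ) (e : Q → ℝ) :
    ∑ b ∈ V, c b * ∑ t ∈ univ.filter (fun t => (b, t) ∈ X) ∩ H, e t
      = ∑ t ∈ H, e t * ∑ b ∈ univ.filter (fun b => (b, t) ∈ X) ∩ V, c b := by
  have lhs : ∑ b ∈ V, c b * ∑ t ∈ univ.filter (fun t => (b, t) ∈ X) ∩ H, e t
      = ∑ b, ∑ t, (if (b, t) ∈ X ∧ b ∈ V ∧ t ∈ H then c b * e t else 0) := by
    rw [← Finset.sum_filter_add_sum_filter_not univ (fun b => b ∈ V)]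
    rw [Finset.filter_mem_eq_inter, Finset.univ_inter]
    have z : ∑ b ∈ univ.filter (fun b => b ∉ V), ∑ t, (if (b, t) ∈ X ∧ b ∈ V ∧ t ∈ H then c b * e t else 0) = 0 :=
      Finset.sum_eq_zero fun b hb => Finset.sum_eq_zero fun t _ => by
        have hb' : b ∉ V := (Finset.mem_filter.1 hb).2
        simp [hb']
    rw [z, add_zero]
    refine Finset.sum_congr rfl fun b hb => ?_
    rw [Finset.mul_sum, ← Finset.sum_filter]
    congr 1
    ext t; simp [hb]
  have rhs : ∑ t ∈ H, e t * ∑ b ∈ univ.filter (fun b => (b, t) ∈ X) ∩ V, c b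
      = ∑ t, ∑ b, (if (b, t) ∈ X ∧ b ∈ V ∧ t ∈ H then c b * e t else 0) := by
    rw [← Finset.sum_filter_add_sum_filter_not univ (fun t => t ∈ H)]
    rw [Finset.filter_mem_eq_inter, Finset.univ_inter]
    have z : ∑ t ∈ univ.filter (fun t => t ∉ H), ∑ b, (if (b, t) ∈ X ∧ b ∈ V ∧ t ∈ H then c b * e t else 0) = 0 :=
      Finset.sum_eq_zero fun t ht => Finset.sum_eq_zero fun b _ => by
        have ht' : t ∉ H := (Finset.mem_filter.1 ht).2
        simp [ht']
    rw [z, add_zero]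
    refine Finset.sum_congr rfl fun t ht => ?_
    rw [Finset.mul_sum, ← Finset.sum_filter]
    have hf : univ.filter (fun b => (b, t) ∈ X ∧ b ∈ V ∧ t ∈ H) = univ.filter (fun b => (b, t) ∈ X) ∩ V := by
      ext b; simp [ht]
    rw [hf]
    exact Finset.sum_congr rfl fun b _ => by ring
  rw [lhs, rhs, Finset.sum_comm]

omit [PartialOrder B] [PartialOrder Q] in
/-- `Q`-section sum of a function that factors through the section: `Σ_{x∈X} f(x) = Σ_b Σ_{t∈X_b} f(b,t)` split at `V`. [folklore] -/
theorem sum_sections_split (X : Finset (B × Q)) (V : Finset B) (f : B × Q → ℝ) :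
    ∑ x ∈ X, f x = ∑ b ∈ V, ∑ t ∈ univ.filter (fun t => (b, t) ∈ X), f (b, t)
      + ∑ b ∈ Vᶜ, ∑ t ∈ univ.filter (fun t => (b, t) ∈ X), f (b, t) := by
  rw [sum_sectionsQ, Finset.sum_add_sum_compl]

omit [Fintype B] [DecidableEq B] [PartialOrder B] [PartialOrder Q] in
/-- Splitting a section sum at `G`. [folklore] -/
theorem sum_sec_split (Y : Finset Q) (G : Finset Q) (f : Q → ℝ) :
    ∑ t ∈ Y, f t = ∑ t ∈ Y ∩ G, f t + ∑ t ∈ Y ∩ Gᶜ, f t := by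
  rw [← Finset.sdiff_eq_inter_compl, Finset.sum_inter_add_sum_sdiff]

/-- **The cap inequality of a rank-one composite decouples.**  See the module docstring: (C_V) for `φ` on `B`, (C_G) for `ψ` on `Q`,
and `u ≤ μ_V + μ_G` imply (C) for `R = (1+d)w⊗ν' | φ⊗ν' | w⊗ψ | 0` on `V×G | V×Gᶜ | Vᶜ×G | Vᶜ×Gᶜ`, for every up-set `W` of `B × Q`.
[this work] -/
theorem cap_rankOne {w : B → ℝ} {ν' : Q → ℝ} (hw : ∀ b, 0 ≤ w b) (hν' : ∀ t, 0 ≤ ν' t)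
    (V : Finset B) (G : Finset Q) (u d μV μG : ℝ) (hμ : u ≤ μV + μG) (φ : B → ℝ) (ψ : Q → ℝ)
    (hCV : ∀ I : Finset B, IsUpperSet (I : Set B) →
      ∑ b ∈ I ∩ V, φ b + μV * ∑ b ∈ I ∩ Vᶜ, w b ≤ (1 + d) * ∑ b ∈ I ∩ V, w b)
    (hCG : ∀ J : Finset Q, IsUpperSet (J : Set Q) →
      ∑ t ∈ J ∩ G, ψ t + μG * ∑ t ∈ J ∩ Gᶜ, ν' t ≤ (1 + d) * ∑ t ∈ J ∩ G, ν' t)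
    (ν : B × Q → ℝ) (hν : ∀ x, ν x = w x.1 * ν' x.2)
    (R : B × Q → ℝ)
    (hR : ∀ x, R x = if x.1 ∈ V then (if x.2 ∈ G then (1 + d) * w x.1 * ν' x.2 else φ x.1 * ν' x.2)
      else (if x.2 ∈ G then w x.1 * ψ x.2 else 0))
    (U : Finset (B × Q)) (hU : ∀ x, x ∈ U ↔ (x.1 ∈ V ∨ x.2 ∈ G))
    (W : Finset (B × Q)) (hW : IsUpperSet (W : Set (B × Q))) :
    ∑ x ∈ W, R x + u * ∑ x ∈ W ∩ Uᶜ, ν x ≤ (1 + d) * ∑ x ∈ W ∩ U, ν x := by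
  -- notation for sections
  set Wb : B → Finset Q := fun b => univ.filter (fun t => (b, t) ∈ W) with hWb
  -- (i) `R(W)` by sections
  have eR : ∑ x ∈ W, R x = ∑ b ∈ V, ((1 + d) * w b * ∑ t ∈ Wb b ∩ G, ν' t + φ b * ∑ t ∈ Wb b ∩ Gᶜ, ν' t)
      + ∑ b ∈ Vᶜ, w b * ∑ t ∈ Wb b ∩ G, ψ t := by
    rw [sum_sections_split W V R]
    congr 1
    · refine Finset.sum_congr rfl fun b hb => ?_
      rw [sum_sec_split (Wb b) G, Finset.mul_sum, Finset.mul_sum]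
      congr 1
      · exact Finset.sum_congr rfl fun t ht => by
          rw [hR]; simp only [hb, (Finset.mem_inter.1 ht).2, ↓reduceIte]
      · exact Finset.sum_congr rfl fun t ht => by
          have ht' : t ∉ G := Finset.mem_compl.1 (Finset.mem_inter.1 ht).2
          rw [hR]; simp only [hb, ht', ↓reduceIte]
    · refine Finset.sum_congr rfl fun b hb => ?_
      have hb' : b ∉ V := Finset.mem_compl.1 hb
      rw [sum_sec_split (Wb b) G, Finset.mul_sum]
      have z : ∑ t ∈ Wb b ∩ Gᶜ, R (b, t) = 0 := Finset.sum_eq_zero fun t ht => by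
        have ht' : t ∉ G := Finset.mem_compl.1 (Finset.mem_inter.1 ht).2
        rw [hR]; simp only [hb', ht', ↓reduceIte]
      rw [z, add_zero]
      exact Finset.sum_congr rfl fun t ht => by
        rw [hR]; simp only [hb', (Finset.mem_inter.1 ht).2, ↓reduceIte]
  -- (ii) `ν(W ∖ U)` by sections
  have eD : ∑ x ∈ W ∩ Uᶜ, ν x = ∑ b ∈ Vᶜ, w b * ∑ t ∈ Wb b ∩ Gᶜ, ν' t := by
    rw [sum_sections_split (W ∩ Uᶜ) V ν]
    have z : ∑ b ∈ V, ∑ t ∈ univ.filter (fun t => (b, t) ∈ W ∩ Uᶜ), ν (b, t) = 0 :=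
      Finset.sum_eq_zero fun b hb => Finset.sum_eq_zero fun t ht => by
        simp only [Finset.mem_filter, Finset.mem_univ, true_and, Finset.mem_inter, Finset.mem_compl, hU] at ht
        exact absurd (Or.inl hb) ht.2
    rw [z, zero_add]
    refine Finset.sum_congr rfl fun b hb => ?_
    have hb' : b ∉ V := Finset.mem_compl.1 hb
    have hf : univ.filter (fun t => (b, t) ∈ W ∩ Uᶜ) = Wb b ∩ Gᶜ := by
      ext t; simp [hWb, hU, hb']
    rw [hf, Finset.mul_sum]
    exact Finset.sum_congr rfl fun t _ => by rw [hν]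
  -- (iii) `ν(W ∩ U)` by sections
  have eUW : ∑ x ∈ W ∩ U, ν x = ∑ b ∈ V, w b * ∑ t ∈ Wb b, ν' t + ∑ b ∈ Vᶜ, w b * ∑ t ∈ Wb b ∩ G, ν' t := by
    rw [sum_sections_split (W ∩ U) V ν]
    congr 1
    · refine Finset.sum_congr rfl fun b hb => ?_
      have hf : univ.filter (fun t => (b, t) ∈ W ∩ U) = Wb b := by
        ext t; simp [hWb, hU, hb]
      rw [hf, Finset.mul_sum]
      exact Finset.sum_congr rfl fun t _ => by rw [hν]
    · refine Finset.sum_congr rfl fun b hb => ?_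
      have hb' : b ∉ V := Finset.mem_compl.1 hb
      have hf : univ.filter (fun t => (b, t) ∈ W ∩ U) = Wb b ∩ G := by
        ext t; simp [hWb, hU, hb']
      rw [hf, Finset.mul_sum]
      exact Finset.sum_congr rfl fun t _ => by rw [hν]
  -- the `V`-rows: `Σ_{b∈V} (φ(b) − (1+d)w(b))·ν'(W_b ∖ G) + μ_V·Σ_{b∉V} w(b)ν'(W_b ∖ G) ≤ 0`
  have hVrows : ∑ b ∈ V, (φ b - (1 + d) * w b) * ∑ t ∈ Wb b ∩ Gᶜ, ν' t
      + μV * ∑ b ∈ Vᶜ, w b * ∑ t ∈ Wb b ∩ Gᶜ, ν' t ≤ 0 := by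
    rw [interchange W V Gᶜ (fun b => φ b - (1 + d) * w b) ν', interchange W Vᶜ Gᶜ w ν',
      Finset.mul_sum Gᶜ (fun t => ν' t * ∑ b ∈ univ.filter (fun b => (b, t) ∈ W) ∩ Vᶜ, w b) μV,
      ← Finset.sum_add_distrib]
    refine Finset.sum_nonpos fun s _ => ?_
    have hup : IsUpperSet ((univ.filter (fun b => (b, s) ∈ W) : Finset B) : Set B) := isUpperSet_secB hW s
    have h := hCV (univ.filter (fun b => (b, s) ∈ W)) hup
    have hs := hν' s
    have e : ∑ b ∈ univ.filter (fun b => (b, s) ∈ W) ∩ V, (φ b - (1 + d) * w b)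
        = ∑ b ∈ univ.filter (fun b => (b, s) ∈ W) ∩ V, φ b - (1 + d) * ∑ b ∈ univ.filter (fun b => (b, s) ∈ W) ∩ V, w b := by
      rw [Finset.sum_sub_distrib, ← Finset.mul_sum]
    rw [e]
    nlinarith [mul_le_mul_of_nonneg_left h hs]
  -- the `Vᶜ`-rows: (C_G) section by section
  have hVcrows : ∀ b, ∑ t ∈ Wb b ∩ G, ψ t + μG * ∑ t ∈ Wb b ∩ Gᶜ, ν' t ≤ (1 + d) * ∑ t ∈ Wb b ∩ G, ν' t :=
    fun b => hCG (Wb b) (isUpperSet_secQ hW b)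
  -- assemble
  rw [eR, eD, eUW]
  have e1 : ∀ b, ∑ t ∈ Wb b, ν' t = ∑ t ∈ Wb b ∩ G, ν' t + ∑ t ∈ Wb b ∩ Gᶜ, ν' t := fun b => sum_sec_split (Wb b) G ν'
  have key : ∑ b ∈ Vᶜ, w b * ∑ t ∈ Wb b ∩ G, ψ t + (u - μV) * ∑ b ∈ Vᶜ, w b * ∑ t ∈ Wb b ∩ Gᶜ, ν' t
      ≤ (1 + d) * ∑ b ∈ Vᶜ, w b * ∑ t ∈ Wb b ∩ G, ν' t := by
    rw [Finset.mul_sum, Finset.mul_sum, ← Finset.sum_add_distrib]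
    refine Finset.sum_le_sum fun b _ => ?_
    have h := hVcrows b
    have hw0 := hw b
    have hG0 : 0 ≤ ∑ t ∈ Wb b ∩ Gᶜ, ν' t := Finset.sum_nonneg fun t _ => hν' t
    nlinarith [mul_le_mul_of_nonneg_left h hw0, mul_nonneg hw0 hG0]
  have eVrows : ∑ b ∈ V, ((1 + d) * w b * ∑ t ∈ Wb b ∩ G, ν' t + φ b * ∑ t ∈ Wb b ∩ Gᶜ, ν' t)
      - (1 + d) * ∑ b ∈ V, w b * ∑ t ∈ Wb b, ν' t
      = ∑ b ∈ V, (φ b - (1 + d) * w b) * ∑ t ∈ Wb b ∩ Gᶜ, ν' t := by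
    rw [Finset.mul_sum, ← Finset.sum_sub_distrib]
    exact Finset.sum_congr rfl fun b _ => by rw [e1 b]; ring
  linarith [hVrows, key, eVrows]

end Summit.CriticalPhenomena.PercolationContinuityZ3.Theorems.SahiE3IndepOrRankOneCap
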